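import Summits.BirchSwinnertonDyer.Rank1Residual.ManinAdditive.RamifiedTwistOptimalityCommutesProof
import Summits.BirchSwinnertonDyer.Rank1Residual.Additive.GordTwistMinimalModel
import Literature.NumberTheory.Automorphic.ShimuraCurveRibetTakahashiOptimalModularityProofs
import Literature.NumberTheory.EllipticCurves.IsogenyConductorModularityProofs
import Literature.NumberTheory.EllipticCurves.ModularParametrizationTrustBaseProofs
import Literature.NumberTheory.EllipticCurves.ModularParametrizationDegreeHoldsProofs
import Literature.NumberTheory.EllipticCurves.IsogenyQuadraticTwistProofs
import Literature.NumberTheory.EllipticCurves.QuadraticTwistPadicReduction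
import Literature.NumberTheory.EllipticCurves.SzpiroLocalDataProofs
import Literature.NumberTheory.EllipticCurves.MultiplicativeComponentGroupOrder
import Literature.NumberTheory.DiophantineGeometry.ConductorExponentLeTwoProofs
import HarnessLib

/-!
# Route `ManinLocalTwoThree`, residual crux C5 `ManinPrimeToAdditiveFiveLe`
# (stmt-BirchSwinnertonDyer-22969), line `upper_anchor`: STUB 1 `stub_optimalPartner`
# — **the commuting optimal `χ_{p*}`-partner of a twist-minimal optimal curve with `W[p]` irreducible**

The registered stub `stub_optimalPartner` of the line skeleton
`Cruxes/ManinPrimeToAdditiveFiveLe/Lines/upper_anchor.lean` (sha16 b6313bd2b9b9b148), proved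
verbatim. Granted the Modularity Theorem (`exists_isNewformOf`): let `p ≥ 5` be prime, `W/ℚ`
globally minimal with a lattice-optimal datum `D` at level `N(W)` (`Λ_W = c · Λ_f`), `p² ∣ N(W)`,
suppose the class of `W` is twist-minimal at `p` (no globally minimal `W'` with `W ∼ W' ⊗ χ_{p*}`
and `p² ∤ N(W')`) and `W[p]` is irreducible. Then there is a globally minimal `W'` with a
lattice-optimal datum `D'` at level `N(W') = N(W)` and a change of variables `u` over `ℚ` with
`u • (W ⊗ χ_{p*}) = W'`.

Proof (a composition of tree theorems, no new mathematics):
* `exists_isIsogenous_latticeOptimal` (§1): granted modularity, EVERY elliptic `T/ℚ` is isogenous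
  to a globally minimal `W₀` carrying a lattice-optimal datum at its own conductor level — the
  newform of `T` (`exists_isNewformOf`), a datum of `T` (`nonempty_modularParametrizationData_of_isNewformOf`),
  the optimal datum of its class by Edixhoven's Prop. 2 (`exists_optimalDatum_of_edixhoven`, fed
  with the tree THEOREM `edixhoven_int_of_neronLattice_eq_smul_periodLattice_holds`), and
  `level = conductor` (`IsNewformOf.level_eq_conductorNorm_of_exists_isNewformOf`);
* `conductorNorm_eq_of_isIsogenous_twist_pStar_of_sq_dvd` (§2): if `W ∼ W' ⊗ χ_{p*}`, `p ≥ 5`, and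
  BOTH conductors are divisible by `p²`, then `N(W') = N(W)` — off `p` the exponents agree
  (`χ_{p*}` is unramified off `p`: `Additive.conductorExponent_eq_of_twist_pStar_of_ne`; the
  conductor is an isogeny invariant granted modularity: `conductorNorm_eq_of_isIsogenous_of_modularity`),
  at `p` both exponents equal `2` (`f_p ≤ 2` for `p ≥ 5`, Silverman ATAEC IV.10.4, tree
  `conductorExponent_le_two_of_five_le_natGenerator_holds`);
* §3: apply §1 to `T = W ⊗ χ_{p*}`; `W ≅ T ⊗ χ_{p*}` (`(W ⊗ d) ⊗ d = C • W`, AEC X.5.4) and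
  `T ∼ W₀` give `W ∼ W₀ ⊗ χ_{p*}`, so twist-minimality forces `p² ∣ N(W₀)`, §2 gives
  `N(W₀) = N(W)`, and the cell's PROVED orbit-commutation
  `pStar_optimal_orbit_commutes_of_irreducible` (irreducible `W[p]` ⇒ no flip) upgrades `T ∼ W₀`
  to `u • T = W₀`.

Nothing here proves BSD, Manin's conjecture, or crux C5: this is the size-M bookkeeping stub of the
line; the open content of the line is in its stubs 2–4. Seat bsd-line-ml23-c5-p1-w2 (width prover).

References: [SilvermanAEC2009] X.5 Cor. 5.4, III.4; [SilvermanATAEC1994] IV.9.4, IV.10.4;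
[EdixhovenManin1991] Prop. 2; [DiamondShurman2005] Thm. 8.8.3; [Watkins2002] §2.1.
-/

set_option autoImplicit false
set_option linter.dupNamespace false

noncomputable section

open scoped Classical NumberField

namespace Summit.BirchSwinnertonDyer.BirchSwinnertonDyer.Theorems

open WeierstrassCurve IsDedekindDomain IsDedekindDomain.HeightOneSpectrum Rat.HeightOneSpectrum
  Literature.NumberTheory.Automorphic
  Literature.NumberTheory.EllipticCurves Literature.NumberTheory.EllipticCurves.ModularForms
  Summit.BirchSwinnertonDyer.Rank1Residual.ManinAdditive

/-! ## §1 Every modular elliptic curve is isogenous to a lattice-optimal globally minimal curve -/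

/-- **Lattice-optimal representative of an isogeny class, from a datum at any level** (granted
modularity, used only for `level = conductor`): if `T/ℚ` carries a modular parametrisation datum at
level `N`, then some globally minimal `W₀ ∼ T` carries a LATTICE-OPTIMAL datum (`Λ_{W₀} = c · Λ_f`)
at level `N(W₀)` (`= N`). Edixhoven's Prop. 2 (tree theorem
`edixhoven_int_of_neronLattice_eq_smul_periodLattice_holds`) via `exists_optimalDatum_of_edixhoven`.
[cite: EdixhovenManin1991, Prop. 2] [cite: DiamondShurman2005, Thm. 8.8.3] -/
theorem exists_isIsogenous_latticeOptimal_of_datum (hnf : exists_isNewformOf)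
    {T : WeierstrassCurve ℚ} [T.IsElliptic] {N : ℕ} [NeZero N]
    (DT : ModularParametrizationData T N) :
    ∃ (W₀ : WeierstrassCurve ℚ) (_ : W₀.IsElliptic) (_ : W₀.IsGloballyMinimal)
      (_ : NeZero (W₀.conductorNorm ℤ)) (D₀ : ModularParametrizationData W₀ (W₀.conductorNorm ℤ)),
      IsLatticeOptimal D₀ ∧ IsIsogenous T W₀ := by
  obtain ⟨W₀, hE₀, hM₀, D₀, -, hiso, hopt, -⟩ := DT.exists_optimalDatum_of_edixhoven
    (fun hf' hL' q hq hq' ↦ edixhoven_int_of_neronLattice_eq_smul_periodLattice_holds hf' hL' q hq hq')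
  haveI := hE₀
  obtain rfl : N = W₀.conductorNorm ℤ :=
    IsNewformOf.level_eq_conductorNorm_of_exists_isNewformOf hnf D₀.isNewformOf
  exact ⟨W₀, hE₀, hM₀, inferInstance, D₀, hopt, hiso⟩

/-- **Granted modularity, every elliptic curve `T/ℚ` is isogenous to a globally minimal curve `W₀`
carrying a lattice-optimal datum at level `N(W₀)`** (the optimal curve of its class in the
lattice sense `Λ_{W₀} = c · Λ_f`): the newform of `T` (`exists_isNewformOf`, Diamond–Shurman
Thm. 8.8.3), a datum of `T` (`nonempty_modularParametrizationData_of_isNewformOf`), and §1's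
`exists_isIsogenous_latticeOptimal_of_datum`. [cite: DiamondShurman2005, Thm. 8.8.3]
[cite: EdixhovenManin1991, Prop. 2] -/
theorem exists_isIsogenous_latticeOptimal (hnf : exists_isNewformOf)
    (T : WeierstrassCurve ℚ) [T.IsElliptic] :
    ∃ (W₀ : WeierstrassCurve ℚ) (_ : W₀.IsElliptic) (_ : W₀.IsGloballyMinimal)
      (_ : NeZero (W₀.conductorNorm ℤ)) (D₀ : ModularParametrizationData W₀ (W₀.conductorNorm ℤ)),
      IsLatticeOptimal D₀ ∧ IsIsogenous T W₀ := by
  haveI : NeZero (T.conductorNorm ℤ) := ⟨(conductorNorm_pos_holds T).ne'⟩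
  obtain ⟨f, hf⟩ := hnf T
  obtain ⟨DT⟩ := nonempty_modularParametrizationData_of_isNewformOf hf
  exact exists_isIsogenous_latticeOptimal_of_datum hnf DT

/-! ## §2 Conductor of a `χ_{p*}`-twist pair additive at `p ≥ 5` on both sides -/

/-- **`N(W') = N(W)` for `W ∼ W' ⊗ ℚ(√p*)`, `p ≥ 5`, `p² ∣ N(W)` and `p² ∣ N(W')`** (granted
modularity): `N(W) = N(W' ⊗ χ_{p*})` (the conductor is an isogeny invariant granted modularity,
`conductorNorm_eq_of_isIsogenous_of_modularity`); off `p` the conductor exponents of `W' ⊗ χ_{p*}`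
and `W'` agree (`χ_{p*}`, `p* ≡ 1 (mod 4)`, is unramified at every `v ∤ p`:
`Additive.conductorExponent_eq_of_twist_pStar_of_ne`), and at `p` both exponents are `2`
(`2 ≤ f_p` from `p² ∣ N`, `f_p ≤ 2` at `p ≥ 5`, Silverman ATAEC IV.10.4).
[cite: SilvermanATAEC1994, IV.9.4, IV.10.4 and Exercise 4.40] -/
theorem conductorNorm_eq_of_isIsogenous_twist_pStar_of_sq_dvd (hnf : exists_isNewformOf)
    {p : ℕ} [Fact p.Prime] (h5 : 5 ≤ p)
    {W : WeierstrassCurve ℚ} [W.IsElliptic] {W' : WeierstrassCurve ℚ} [W'.IsElliptic]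
    (htw : IsIsogenous W (W'.quadraticTwist (((-1 : ℤ) ^ (p / 2) * p : ℤ) : ℚ)))
    (hpN : p ^ 2 ∣ W.conductorNorm ℤ) (hpN' : p ^ 2 ∣ W'.conductorNorm ℤ) :
    W'.conductorNorm ℤ = W.conductorNorm ℤ := by
  have hp : p.Prime := Fact.out
  have hp2 : p ≠ 2 := by omega
  have hd0 : ((((-1 : ℤ) ^ (p / 2) * p : ℤ)) : ℚ) ≠ 0 := by
    push_cast
    exact mul_ne_zero (pow_ne_zero _ (by norm_num)) (by exact_mod_cast hp.ne_zero)
  haveI : (W'.quadraticTwist (((-1 : ℤ) ^ (p / 2) * p : ℤ) : ℚ)).IsElliptic :=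
    W'.isElliptic_quadraticTwist hd0
  -- the conductor is an isogeny invariant (granted modularity): `N(W) = N(W' ⊗ χ_{p*})`
  have hWV : W.conductorNorm ℤ =
      (W'.quadraticTwist (((-1 : ℤ) ^ (p / 2) * p : ℤ) : ℚ)).conductorNorm ℤ :=
    conductorNorm_eq_of_isIsogenous_of_modularity
      (nonempty_modularParametrizationData_of_exists_isNewformOf hnf
        IsNewformOf.exists_maninConstant_ne_zero_holds) _ _ htw
  have hC : (1 : VariableChange ℚ) • W'.quadraticTwist ((-1 : ℚ) ^ (p / 2) * p) =
      W'.quadraticTwist (((-1 : ℤ) ^ (p / 2) * p : ℤ) : ℚ) := by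
    rw [one_smul]; push_cast; rfl
  have hpV : p ^ 2 ∣ (W'.quadraticTwist (((-1 : ℤ) ^ (p / 2) * p : ℤ) : ℚ)).conductorNorm ℤ :=
    hWV ▸ hpN
  rw [hWV]
  refine Nat.eq_of_factorization_eq (conductorNorm_pos_holds W').ne' (conductorNorm_pos_holds _).ne'
    fun r ↦ ?_
  by_cases hr : r.Prime
  · have e1 := factorization_conductorNorm_primesEquiv_symm
      (W'.quadraticTwist (((-1 : ℤ) ^ (p / 2) * p : ℤ) : ℚ)) ⟨r, hr⟩
    have e2 := factorization_conductorNorm_primesEquiv_symm W' ⟨r, hr⟩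
    simp only at e1 e2
    have hgen : natGenerator ((primesEquiv (R := ℤ)).symm ⟨r, hr⟩) = r :=
      natGenerator_primesEquiv_symm hr
    by_cases hrp : r = p
    · -- at `p`: both exponents are `2`
      have h5r : 5 ≤ natGenerator ((primesEquiv (R := ℤ)).symm ⟨r, hr⟩) := by rw [hgen]; omega
      have le1 := ((W'.quadraticTwist (((-1 : ℤ) ^ (p / 2) * p : ℤ) :
        ℚ)).conductorExponent_le_two_of_five_le_natGenerator_holds _) h5r
      have le2 := (W'.conductorExponent_le_two_of_five_le_natGenerator_holds _) h5r
      have ge1 : 2 ≤ ((W'.quadraticTwist (((-1 : ℤ) ^ (p / 2) * p : ℤ) : ℚ)).conductorNorm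
          ℤ).factorization r :=
        (hr.pow_dvd_iff_le_factorization (conductorNorm_pos_holds _).ne').mp (hrp ▸ hpV)
      have ge2 : 2 ≤ (W'.conductorNorm ℤ).factorization r :=
        (hr.pow_dvd_iff_le_factorization (conductorNorm_pos_holds W').ne').mp (hrp ▸ hpN')
      omega
    · -- off `p`: `χ_{p*}` is unramified
      rw [e1, e2]
      exact (Summit.BirchSwinnertonDyer.Rank1Residual.Additive.conductorExponent_eq_of_twist_pStar_of_ne
        p hp2 W' _ 1 hC _ (by rw [hgen]; exact hrp)).symm
  · simp [Nat.factorization_eq_zero_of_not_prime _ hr]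

/-! ## §3 The stub -/

/-- **STUB 1 `stub_optimalPartner` of line `upper_anchor` (crux C5 `ManinPrimeToAdditiveFiveLe`,
stmt-BirchSwinnertonDyer-22969), verbatim — the commuting optimal partner.** Granted modularity:
for `W/ℚ` globally minimal with a lattice-optimal conductor-level datum `D`, `p ≥ 5`, `p² ∣ N(W)`,
`W` NOT a `χ_{p*}`-twist of a globally minimal curve of conductor prime-to-`p²` (twist-minimality
at `p`) and `W[p]` irreducible, there is a globally minimal `W'` with a lattice-optimal
conductor-level datum `D'`, `N(W') = N(W)`, and an isomorphism `u • (W ⊗ χ_{p*}) = W'`.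
Proof: §1 applied to `T = W ⊗ χ_{p*}` gives the lattice-optimal `W₀ ∼ T`; `W ≅ T ⊗ χ_{p*}`
(AEC X.5.4) gives `W ∼ W₀ ⊗ χ_{p*}`, so twist-minimality yields `p² ∣ N(W₀)` and §2 yields
`N(W₀) = N(W)`; the cell's PROVED `pStar_optimal_orbit_commutes_of_irreducible` (irreducible
`W[p]` ⇒ the lattice-optimal curve of the twisted class IS a model of the twist) gives `u`.
[cite: SilvermanAEC2009, X.5 Cor. 5.4] [cite: Watkins2002, §2.1] [cite: EdixhovenManin1991, Prop. 2] -/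
theorem stub_optimalPartner :
    exists_isNewformOf →
    ∀ {p : ℕ}, p.Prime → 5 ≤ p →
    ∀ (W : WeierstrassCurve ℚ) [W.IsElliptic] [W.IsGloballyMinimal] [NeZero (W.conductorNorm ℤ)]
      (D : ModularParametrizationData W (W.conductorNorm ℤ)),
      IsLatticeOptimal D → p ^ 2 ∣ W.conductorNorm ℤ →
      ¬ (∃ (W' : WeierstrassCurve ℚ), W'.IsElliptic ∧ W'.IsGloballyMinimal ∧
          IsIsogenous W (W'.quadraticTwist (((-1 : ℤ) ^ (p / 2) * p : ℤ) : ℚ)) ∧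
          ¬ p ^ 2 ∣ W'.conductorNorm ℤ) →
      W.HasIrreducibleModPGaloisRep p →
      ∃ (W' : WeierstrassCurve ℚ) (_ : W'.IsElliptic) (_ : W'.IsGloballyMinimal)
        (_ : NeZero (W'.conductorNorm ℤ)) (u : VariableChange ℚ)
        (D' : ModularParametrizationData W' (W'.conductorNorm ℤ)),
        IsLatticeOptimal D' ∧ W'.conductorNorm ℤ = W.conductorNorm ℤ ∧
        u • W.quadraticTwist ((((-1 : ℤ) ^ (p / 2) * p : ℤ)) : ℚ) = W' := by
  intro hnf p hp h5 W _ _ _ D hD hpN hmin hirr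
  haveI : Fact p.Prime := ⟨hp⟩
  have hp2 : p ≠ 2 := by omega
  have hd0 : ((((-1 : ℤ) ^ (p / 2) * p : ℤ)) : ℚ) ≠ 0 := by
    push_cast
    exact mul_ne_zero (pow_ne_zero _ (by norm_num)) (by exact_mod_cast hp.ne_zero)
  haveI : (W.quadraticTwist (((-1 : ℤ) ^ (p / 2) * p : ℤ) : ℚ)).IsElliptic :=
    W.isElliptic_quadraticTwist hd0
  -- §1: the lattice-optimal globally minimal curve `W₀` of the class of `T = W ⊗ χ_{p*}`
  obtain ⟨W₀, hE₀, hM₀, hne₀, D₀, hD₀, hiso⟩ :=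
    exists_isIsogenous_latticeOptimal hnf (W.quadraticTwist (((-1 : ℤ) ^ (p / 2) * p : ℤ) : ℚ))
  haveI := hE₀
  haveI := hM₀
  haveI := hne₀
  haveI : (W₀.quadraticTwist (((-1 : ℤ) ^ (p / 2) * p : ℤ) : ℚ)).IsElliptic :=
    W₀.isElliptic_quadraticTwist hd0
  -- `W ∼ W₀ ⊗ χ_{p*}`: `W ≅ (W ⊗ p*) ⊗ p*` and `W ⊗ p* ∼ W₀`
  have htw : IsIsogenous W (W₀.quadraticTwist (((-1 : ℤ) ^ (p / 2) * p : ℤ) : ℚ)) := by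
    obtain ⟨C, hC⟩ := W.exists_variableChange_smul_eq_quadraticTwist_sq hd0
    have h1 : IsIsogenous W ((W.quadraticTwist (((-1 : ℤ) ^ (p / 2) * p : ℤ) : ℚ)).quadraticTwist
        (((-1 : ℤ) ^ (p / 2) * p : ℤ) : ℚ)) := by
      rw [quadraticTwist_quadraticTwist, ← sq, ← hC]
      exact isIsogenous_smul _ _
    exact h1.trans' (hiso.quadraticTwist hd0)
  -- twist-minimality at `p`: `p² ∣ N(W₀)`; hence `N(W₀) = N(W)` (§2)
  have hpN₀ : p ^ 2 ∣ W₀.conductorNorm ℤ := by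
    by_contra h
    exact hmin ⟨W₀, hE₀, hM₀, htw, h⟩
  have hNN : W₀.conductorNorm ℤ = W.conductorNorm ℤ :=
    conductorNorm_eq_of_isIsogenous_twist_pStar_of_sq_dvd hnf h5 htw hpN hpN₀
  -- irreducible `W[p]`: optimality commutes with the twist
  obtain ⟨u, hu⟩ :=
    pStar_optimal_orbit_commutes_of_irreducible hp hp2 W W₀ D D₀ hD hD₀ hpN hNN hiso hirr
  exact ⟨W₀, hE₀, hM₀, hne₀, u, D₀, hD₀, hNN, hu⟩

end Summit.BirchSwinnertonDyer.BirchSwinnertonDyer.Theorems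

end
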